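import Summits.Ventures.HodgeRepro2.T5HeckeInvariantsDetermine
import Mathlib.LinearAlgebra.TensorProduct.Basic

/-!
# The `G`-span of a pure tensor `u ⊗ w` with `w` in an irreducible representation

Kernel annex of the Tier-5 record (blind lane).  N3.L7 uses: «write `u = u_∞ ⊗ u_f` with `u_∞` in
the (one-dimensional) `τ′`-isotypic part, so the `H(𝔸_f)`-span of `u` is `u_∞ ⊗ π₀,f`
(`π₀,f` irreducible)».  In kernel form, with `G` acting on the second factor only:

* `span_orbit_eq_top` — for `ω` irreducible and `w ≠ 0`, the `k`-span of the orbit `{ω(g) w}` is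
  all of `W` (the span is `G`-stable, hence `⊥` or `⊤` — `T5HeckeInvariantsDetermine`'s
  `eq_bot_or_eq_top_of_stable`);
* `span_tmul_orbit_eq_range` — `span {u ⊗ₜ ω(g) w : g ∈ G} = range (u ⊗ₜ ·)` (`= u ⊗ W`);
* `mem_span_tmul_orbit_iff` — `x` lies in that span iff `x = u ⊗ₜ w'` for some `w'`;
* `tmul_mem_span_tmul_orbit` — in particular every `u ⊗ₜ w'` is in the `G`-span of `u ⊗ₜ w`
  («which contains every `f` with archimedean component in `τ′`»).

What stays prose: that the `τ′`-isotypic part is one-dimensional (row T7 of the record) and that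
the `H(𝔸_f)`-module structure of the record is the one on the second factor; the printed theorems.
-/

namespace Summit.Ventures.HodgeRepro2.T5PureTensorSpan

open TensorProduct

variable {G : Type*} [Group G] {k : Type*} [Field k]
  {U : Type*} [AddCommGroup U] [Module k U] {W : Type*} [AddCommGroup W] [Module k W]
  (ω : Representation k G W)

/-- The span of a `G`-orbit is `G`-stable. -/
theorem apply_mem_span_orbit (w : W) (g : G) {v : W}
    (hv : v ∈ Submodule.span k (Set.range fun g : G => ω g w)) :
    ω g v ∈ Submodule.span k (Set.range fun g : G => ω g w) := by
  refine Submodule.span_induction ?_ ?_ ?_ ?_ hv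
  · rintro _ ⟨h, rfl⟩
    refine Submodule.subset_span ⟨g * h, ?_⟩
    simp only [map_mul, Module.End.mul_apply]
  · simp only [map_zero, Submodule.zero_mem]
  · intro x y _ _ hx hy
    rw [map_add]
    exact Submodule.add_mem _ hx hy
  · intro c x _ hx
    rw [map_smul]
    exact Submodule.smul_mem _ c hx

/-- For `ω` irreducible and `w ≠ 0`, the orbit `{ω(g) w}` spans `W`. -/
theorem span_orbit_eq_top [ω.IsIrreducible] {w : W} (hw : w ≠ 0) :
    Submodule.span k (Set.range fun g : G => ω g w) = ⊤ := by
  rcases T5HeckeInvariantsDetermine.eq_bot_or_eq_top_of_stable ω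
    (S := Submodule.span k (Set.range fun g : G => ω g w))
    (fun g _ hv => apply_mem_span_orbit ω w g hv) with h | h
  · exfalso
    apply hw
    have hmem : w ∈ Submodule.span k (Set.range fun g : G => ω g w) :=
      Submodule.subset_span ⟨1, by simp only [map_one, Module.End.one_apply]⟩
    rw [h, Submodule.mem_bot] at hmem
    exact hmem
  · exact h

/-- `span {u ⊗ₜ ω(g) w} = range (u ⊗ₜ ·)` for `ω` irreducible and `w ≠ 0`: the `G`-span of the
pure tensor `u ⊗ w` (with `G` acting on the second factor) is `u ⊗ W`. -/
theorem span_tmul_orbit_eq_range [ω.IsIrreducible] (u : U) {w : W} (hw : w ≠ 0) :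
    Submodule.span k (Set.range fun g : G => u ⊗ₜ[k] ω g w) =
      LinearMap.range (TensorProduct.mk k U W u) := by
  have h1 : (Set.range fun g : G => u ⊗ₜ[k] ω g w) =
      (TensorProduct.mk k U W u) '' (Set.range fun g : G => ω g w) := by
    ext x
    simp only [Set.mem_range, Set.mem_image, exists_exists_eq_and, TensorProduct.mk_apply]
  rw [h1, ← Submodule.map_span, span_orbit_eq_top ω hw, LinearMap.range_eq_map]

/-- Membership in the `G`-span of `u ⊗ w`: exactly the pure tensors `u ⊗ₜ w'`. -/
theorem mem_span_tmul_orbit_iff [ω.IsIrreducible] (u : U) {w : W} (hw : w ≠ 0) (x : U ⊗[k] W) :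
    x ∈ Submodule.span k (Set.range fun g : G => u ⊗ₜ[k] ω g w) ↔ ∃ w' : W, u ⊗ₜ[k] w' = x := by
  rw [span_tmul_orbit_eq_range ω u hw, LinearMap.mem_range]
  simp only [TensorProduct.mk_apply]

/-- Every `u ⊗ₜ w'` lies in the `G`-span of `u ⊗ₜ w` (`ω` irreducible, `w ≠ 0`). -/
theorem tmul_mem_span_tmul_orbit [ω.IsIrreducible] (u : U) {w : W} (hw : w ≠ 0) (w' : W) :
    u ⊗ₜ[k] w' ∈ Submodule.span k (Set.range fun g : G => u ⊗ₜ[k] ω g w) :=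
  (mem_span_tmul_orbit_iff ω u hw _).2 ⟨w', rfl⟩

/-- The contrapositive form of N3.L7: a linear functional vanishing on the `G`-span of `u ⊗ w`
vanishes on every `u ⊗ₜ w'`. -/
theorem apply_tmul_eq_zero_of_forall [ω.IsIrreducible] {X : Type*} [AddCommGroup X] [Module k X]
    (Λ : U ⊗[k] W →ₗ[k] X) (u : U) {w : W} (hw : w ≠ 0)
    (h0 : ∀ g : G, Λ (u ⊗ₜ[k] ω g w) = 0) (w' : W) : Λ (u ⊗ₜ[k] w') = 0 := by
  have hle : Submodule.span k (Set.range fun g : G => u ⊗ₜ[k] ω g w) ≤ LinearMap.ker Λ := by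
    rw [Submodule.span_le]
    rintro _ ⟨g, rfl⟩
    exact h0 g
  exact hle (tmul_mem_span_tmul_orbit ω u hw w')

end Summit.Ventures.HodgeRepro2.T5PureTensorSpan
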